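import Summits.Parity.GeneralizedHardyLittlewood.Theorems.FordMaynardSieveConst01651SieveConst01651LinePart10
import HarnessLib

/-!
# Route `FordMaynardSieveConst01651`, target `SieveConst01651` (stmt-Parity-19185): line `sieve_decomposition` re-homed — proofs, part 11 of 11 (file 12 of 12)

File 12 of 12 of the VERBATIM re-homing under `Theorems/` of the registered line skeleton
`Summits/Parity/GeneralizedHardyLittlewood/Cruxes/SieveConst01651/Lines/sieve_decomposition.lean` (v21, sha16
`ada6d0765119a11e`; author seat `linewriter-parity-smallroutes-1`, g0 v1–v20 / g1 v21): Ford–Maynard, Theorem 7.3 (a) at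
`P = (1/2, 0, ν)` with CLOSED support, cut along arXiv:2407.14368 §7.2 / §6.2, composed down to the route target
`Summit.Parity.GeneralizedHardyLittlewood.Theses.FordMaynardSieveConst01651.SieveConst01651`.  Namespace
`Summit.Parity.GeneralizedHardyLittlewood.FordMaynardSieveConst01651SieveDecomposition` (fresh; the `Cruxes` copy keeps its own), files of
≤ 400 lines chained by import; the three registered stubs are replaced by their landed proofs
(`…StubSignClauseFive` p834287, `…StubCertValuePos` p837763, `…TypeIIRegion` p833045), so the skeleton's composition
`SieveConst01651_of_stubs` (last part) is sorry-free.  Mathematics, statements and comments are the linewriter's; this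
re-homing (hand `leafhand-parity-fordmaynardsieveco-2` g4) only moved the definitions (`Eset`, `sliceTest`, `mainG1`, `vk`,
the `Signature.*` statement abbreviations, `Phi`, `innerI`, `jumpSet`, `gval`, `symmExt`, `idxProd`, `gam`) into the first
file, added docstrings where missing, and renamed two unused binders.
Declarations in this part: `fm73aClosed_of`, `SieveConst01651_of`, `SieveConst01651_of_stubs`, `SieveConst01651_of_v21`.

References: [FordMaynard2024PrimeSieves] K. Ford, J. Maynard, *On the theory of prime producing sieves*, arXiv:2407.14368,
Theorem 7.3 (a), Proposition 7.19, §6.2, §7.2, §8.2.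
-/

noncomputable section

open Finset
open Literature.NumberTheory.Sieve Literature.NumberTheory.Sieve.FordMaynard Literature.Barriers.Parity.FordMaynard
open Summit.Parity.GeneralizedHardyLittlewood.FordMaynardSieveConst01651SieveConst01651
  (hfun Admissible hfun_apply hfun_of_ne pvec roughPart smoothPart Gwt Hwt window IsRough Nset Rset mem_window mem_Nset mem_Rset
   coneCert openSmall stub_hkPieces stub_coneCertClosed_of_residues' coneCert_signClause_five_of_generic)

namespace Summit.Parity.GeneralizedHardyLittlewood.FordMaynardSieveConst01651SieveDecomposition

/-- **The repaired Theorem 7.3 (a) at `P = (1/2, 0, ν)` from the five lemmas** (two of them PROVED … -/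
theorem fm73aClosed_of (h1 : Signature.signLemma) (h2 : Signature.mainTerm)
    (h3 : Signature.typeITerm) (h4 : Signature.stub_typeIIRegion) (h5 : Signature.squarefullPatch) :
    ∀ ν : ℝ, 0 < ν → ν < 1 / 4 → ∀ g : VecFn, Admissible ν g →
      ∀ c : ℝ, c < sieveBoundG1 ν g → IsLowerSieveConst (1 / 2) 0 ν c := by
  intro ν hν hν4 g hadm c hc ϖ hϖ
  set V := sieveBoundG1 ν g with hV
  set δ := V - c with hδ
  have hδ0 : 0 < δ := by rw [hδ]; linarith
  have hN : ∀ n : ℕ, 2 ≤ n → ¬ n.Prime → IsRough ν n → ¬ IsExc n → Hwt g ν n ≤ 0 := by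
    intro n h2 hp hr he
    rw [Hwt_eq_sum_of_rough hadm h2 hr]
    exact h1 ν hν hν4 g hadm n h2 hp hr he
  obtain ⟨M, hM⟩ := Hwt_abs_le hν hadm.2.1
  have hP : ∀ p : ℕ, p.Prime → Hwt g ν p = 1 := fun p hp => Hwt_prime hadm hp
  set M' := max M 0 with hM'
  have hM'0 : 0 ≤ M' := le_max_right _ _
  have hM'' : ∀ n : ℕ, 2 ≤ n → IsRough ν n → |Hwt g ν n| ≤ M' :=
    fun n h2 hr => (hM n h2 hr).trans (le_max_left _ _)
  have hmain := h2 ν hν hν4 g hadm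
  obtain ⟨x₂, hcheb⟩ := chebyshev_window
  obtain ⟨x₁, hx₁⟩ := hmain (δ / 12) (by positivity)
  obtain ⟨K₃, hK₃⟩ := h3 ν hν hν4 g hadm
  obtain ⟨B₀, hB₀⟩ := h4 ν hν hν4 g hadm 2 (by norm_num) ϖ hϖ.le
  set B := max B₀ 2 with hB
  have hB2 : (2 : ℝ) ≤ B := le_max_right _ _
  have hB0 : 0 < B := by linarith
  obtain ⟨K₄, x₄, hK₄⟩ := hB₀ B (le_max_left _ _)
  set C₁ := |K₃| + |K₄| + 2 * M' + 1 with hC₁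
  have hC₁0 : 0 < C₁ := by positivity
  set C₂ := 7 * M' + 1 with hC₂
  have hC₂0 : 0 < C₂ := by positivity
  set η₁ := δ / (12 * C₁) with hη₁
  set η₂ := δ / (12 * C₂) with hη₂
  have hη₁0 : 0 < η₁ := by positivity
  have hη₂0 : 0 < η₂ := by positivity
  obtain ⟨x₅, hx₅⟩ := eventually_small hν hη₁0
  obtain ⟨x₆, hx₆⟩ := eventually_small hν hη₂0
  refine ⟨B, max (max (max x₁ x₂) (max x₄ x₅)) x₆, hB0, ?_⟩
  intro x hx a ha hgrowth hI hII
  simp only [max_le_iff] at hx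
  obtain ⟨⟨⟨hx1, hx2⟩, hx4, hx5⟩, hx6⟩ := hx
  obtain ⟨h4x, hL1, hpow5, hsq5⟩ := hx₅ x hx5
  obtain ⟨-, -, hpow6, -⟩ := hx₆ x hx6
  have hx2' : (2 : ℝ) ≤ x := by linarith
  have hx0 : 0 < x := by linarith
  have hx1' : (1 : ℝ) ≤ x := by linarith
  have hL0 : 0 < Real.log x := by linarith
  set P : ℝ := ((windowPrimes x).card : ℝ) with hPdef
  have hP0 : 0 ≤ P := by positivity
  set X : ℝ := x / Real.log x with hX
  have hX0 : 0 ≤ X := div_nonneg hx0.le hL0.le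
  set E₁ : ℝ := η₁ * X with hE₁
  set E₂ : ℝ := η₂ * X with hE₂
  have eMain : |∑ n ∈ Nset ν x, Hwt g ν n - (V - 1) * P| ≤ δ / 12 * x / Real.log x := hx₁ x hx1
  have eCheb : x / (3 * Real.log x) ≤ P := hcheb x hx2
  have eI : |∑ n ∈ window x, (a n - 1) * Hwt g ν n| ≤ K₃ * x / Real.log x ^ B :=
    hK₃ x hx2' B (by linarith) (fun n => a n - 1) hI
  have hwlow : ∀ n : ℕ, -(x ^ (ν / 10)) ≤ a n - 1 := fun n => by
    have h1 : (1 : ℝ) ≤ x ^ (ν / 10) := Real.one_le_rpow hx1' (by positivity)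
    linarith [ha n]
  have eII : |∑ n ∈ Rset ν x, (a n - 1) * Hwt g ν n| ≤ K₄ * x / Real.log x ^ (2 : ℝ) :=
    hK₄ x hx4 (fun n => a n - 1) hwlow hgrowth hI hII
  have eSq : ∑ n ∈ Eset ν x, a n ≤ 4 * x ^ (1 - ν) + 2 * Real.sqrt x + 2 + 2 * x / Real.log x ^ B :=
    h5 ν hν hν4 x hx2' B hB0 a ha hI
  have eSieve := sieve_lower (x := x) (M := M') hP hN hM'' ha (g := g) (ν := ν)
  have hLB : x / Real.log x ^ B ≤ x / Real.log x ^ (2 : ℕ) := by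
    apply div_le_div_of_nonneg_left hx0.le (by positivity)
    calc Real.log x ^ (2 : ℕ) = Real.log x ^ ((2 : ℕ) : ℝ) := (Real.rpow_natCast _ 2).symm
      _ ≤ Real.log x ^ B := Real.rpow_le_rpow_of_exponent_le hL1 (by simpa using hB2)
  have hL2r : x / Real.log x ^ (2 : ℝ) = x / Real.log x ^ (2 : ℕ) := by
    rw [Real.rpow_two]
  have hE₁' : x / Real.log x ^ (2 : ℕ) ≤ E₁ := by
    rw [hE₁, hX, ← mul_div_assoc]; exact hsq5
  have hE₂' : x ^ (1 - ν) ≤ E₂ := by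
    rw [hE₂, hX, ← mul_div_assoc]; exact hpow6
  have hsqrt : Real.sqrt x ≤ x ^ (1 - ν) := by
    rw [Real.sqrt_eq_rpow]
    exact Real.rpow_le_rpow_of_exponent_le hx1' (by linarith)
  have htwo : (2 : ℝ) ≤ x ^ (1 - ν) := by
    have : (2 : ℝ) ≤ Real.sqrt x := by
      rw [show (2 : ℝ) = Real.sqrt 4 by
        rw [show (4 : ℝ) = 2 ^ 2 by norm_num, Real.sqrt_sq (by norm_num)]]
      exact Real.sqrt_le_sqrt h4x
    linarith
  have tW : |∑ n ∈ window x, (a n - 1) * Hwt g ν n| ≤ |K₃| * E₁ := by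
    calc |∑ n ∈ window x, (a n - 1) * Hwt g ν n| ≤ K₃ * x / Real.log x ^ B := eI
      _ = K₃ * (x / Real.log x ^ B) := mul_div_assoc _ _ _
      _ ≤ |K₃| * (x / Real.log x ^ B) :=
          mul_le_mul_of_nonneg_right (le_abs_self _) (div_nonneg hx0.le (by positivity))
      _ ≤ |K₃| * E₁ := mul_le_mul_of_nonneg_left (hLB.trans hE₁') (abs_nonneg _)
  have tR : |∑ n ∈ Rset ν x, (a n - 1) * Hwt g ν n| ≤ |K₄| * E₁ := by
    calc |∑ n ∈ Rset ν x, (a n - 1) * Hwt g ν n| ≤ K₄ * x / Real.log x ^ (2 : ℝ) := eII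
      _ = K₄ * (x / Real.log x ^ (2 : ℝ)) := mul_div_assoc _ _ _
      _ ≤ |K₄| * (x / Real.log x ^ (2 : ℝ)) :=
          mul_le_mul_of_nonneg_right (le_abs_self _) (div_nonneg hx0.le (by positivity))
      _ ≤ |K₄| * E₁ := mul_le_mul_of_nonneg_left (hL2r.le.trans hE₁') (abs_nonneg _)
  have tE : M' * ∑ n ∈ Eset ν x, a n ≤ 7 * (M' * E₂) + 2 * (M' * E₁) := by
    have hin : ∑ n ∈ Eset ν x, a n ≤ 7 * E₂ + 2 * E₁ := by
      have h2x : 2 * x / Real.log x ^ B = 2 * (x / Real.log x ^ B) := mul_div_assoc _ _ _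
      rw [h2x] at eSq
      linarith [hLB.trans hE₁']
    calc M' * ∑ n ∈ Eset ν x, a n ≤ M' * (7 * E₂ + 2 * E₁) := mul_le_mul_of_nonneg_left hin hM'0
      _ = 7 * (M' * E₂) + 2 * (M' * E₁) := by ring
  have tMain : V * P - P - δ / 12 * X ≤ ∑ n ∈ Nset ν x, Hwt g ν n := by
    have h := (abs_le.1 eMain).1
    have hre : δ / 12 * x / Real.log x = δ / 12 * X := by rw [hX]; ring
    have hVP : (V - 1) * P = V * P - P := by ring
    linarith
  have bud1 : |K₃| * E₁ + |K₄| * E₁ + 2 * (M' * E₁) ≤ δ / 12 * X := by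
    have hprod : η₁ * C₁ = δ / 12 := by
      rw [hη₁]; field_simp
    calc |K₃| * E₁ + |K₄| * E₁ + 2 * (M' * E₁) = (η₁ * (|K₃| + |K₄| + 2 * M')) * X := by
          rw [hE₁]; ring
      _ ≤ (η₁ * C₁) * X := by
          apply mul_le_mul_of_nonneg_right _ hX0
          apply mul_le_mul_of_nonneg_left _ hη₁0.le
          rw [hC₁]; linarith
      _ = δ / 12 * X := by rw [hprod]
  have bud2 : 7 * (M' * E₂) ≤ δ / 12 * X := by
    have hprod : η₂ * C₂ = δ / 12 := by
      rw [hη₂]; field_simp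
    calc 7 * (M' * E₂) = (η₂ * (7 * M')) * X := by rw [hE₂]; ring
      _ ≤ (η₂ * C₂) * X := by
          apply mul_le_mul_of_nonneg_right _ hX0
          apply mul_le_mul_of_nonneg_left _ hη₂0.le
          rw [hC₂]; linarith
      _ = δ / 12 * X := by rw [hprod]
  have hXP : δ / 4 * X ≤ 3 * δ / 4 * P := by
    have hX3 : X ≤ 3 * P := by
      have : x / (3 * Real.log x) = X / 3 := by rw [hX]; ring
      linarith [eCheb]
    calc δ / 4 * X ≤ δ / 4 * (3 * P) := mul_le_mul_of_nonneg_left hX3 (by positivity)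
      _ = 3 * δ / 4 * P := by ring
  show c * P ≤ ∑ p ∈ windowPrimes x, a p
  calc c * P = (V - δ) * P := by rw [hδ]; ring
    _ ≤ (V - 3 * δ / 4) * P := mul_le_mul_of_nonneg_right (by linarith) hP0
    _ = V * P - 3 * δ / 4 * P := by ring
    _ ≤ ∑ p ∈ windowPrimes x, a p := by
        linarith [eSieve, tW, tR, tE, tMain, bud1, bud2, hXP]

/-- **Composition (kernel-checked)**: the six leaves (four open stubs + the two proved lemmas) give the ROUTE TARGET BY NAME. -/
theorem SieveConst01651_of :
    Signature.stub_coneCertClosed → Signature.signLemma → Signature.mainTerm →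
      Signature.typeITerm → Signature.stub_typeIIRegion → Signature.squarefullPatch →
      Summit.Parity.GeneralizedHardyLittlewood.Theses.FordMaynardSieveConst01651.SieveConst01651 := by
  intro h0 h1 h2 h3 h4 h5 ν hν _hν3
  obtain ⟨g₀, hpc, h00, hsupp, hH, hV⟩ := h0
  have hadm : Admissible (1651 / 10000) (symmExt g₀) :=
    ⟨isSymmetric_symmExt g₀, isPiecewiseConstOnCone_symmExt hpc, fun e => h00 _,
      supportClosed_symmExt hsupp, starSum_nonpos_of_cone hH⟩
  have hconst : IsLowerSieveConst (1 / 2) 0 (1651 / 10000) (sieveBoundG1 (1651 / 10000) g₀ / 2) :=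
    fm73aClosed_of h1 h2 h3 h4 h5 (1651 / 10000) (by norm_num) (by norm_num) (symmExt g₀) hadm _
      (by rw [sieveBoundG1_symmExt]; linarith)
  exact ⟨_, by linarith, hconst.mono hν⟩

/-- **The skeleton instantiated** (v21): the target BY NAME modulo `stub_signClauseFive`, `stub_certValuePos`, `stub_typeIIRegion`. -/
theorem SieveConst01651_of_stubs :
    Summit.Parity.GeneralizedHardyLittlewood.Theses.FordMaynardSieveConst01651.SieveConst01651 :=
  SieveConst01651_of (coneCertClosed_of _root_.Summit.Parity.GeneralizedHardyLittlewood.FordMaynardSieveConst01651SieveConst01651.stub_signClauseFive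
    _root_.Summit.Parity.GeneralizedHardyLittlewood.FordMaynardSieveConst01651SieveConst01651.stub_certValuePos) sign_lemma main_term typeI_term
    _root_.Summit.Parity.GeneralizedHardyLittlewood.FordMaynardSieveConst01651SieveConst01651.stub_typeIIRegion squarefull_patch

/-- **Composition over the v21 leaves** (kernel-checked): R1 → R2 → Prop 7.19 → the ROUTE TARGET BY NAME. -/
theorem SieveConst01651_of_v21 :
    Signature.stub_signClauseFive → Signature.stub_certValuePos → Signature.stub_typeIIRegion →
      Summit.Parity.GeneralizedHardyLittlewood.Theses.FordMaynardSieveConst01651.SieveConst01651 :=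
  fun h₁ h₂ h4 => SieveConst01651_of (coneCertClosed_of h₁ h₂) sign_lemma main_term typeI_term h4 squarefull_patch

end Summit.Parity.GeneralizedHardyLittlewood.FordMaynardSieveConst01651SieveDecomposition

end
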